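import Literature.NumberTheory.Transcendental.RoySmallValueEstimatesLevelDataProofs
import Literature.NumberTheory.Transcendental.RoySmallValueAsymptotics
import Literature.NumberTheory.Transcendental.RoySmallValueEventually
import HarnessLib

/-!
# Small value estimates at rational translates (Nguyen–Roy 2016) — proofs: the "for `D` large enough" numerics of §5

Proofs file towards `Literature.NumberTheory.Transcendental.nguyenRoy2016_thm_1` (Nguyen–Roy, IJNT 12
(2016) = arXiv:1412.5163). Everything here is PROVED; no named facts. Source, §5 (pp. 11–12):

> [...] assuming that `D` is large enough, this gives `h(W) ≤ 5D^{1+β}` [...] Then, assuming that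
> `D` is sufficiently large, all estimates work out and we obtain
> `h_{𝒞_D}(ℙ²(ℂ)) ≤ −TU + 3YD² + 21 log(3) D³` [...] Since `β > 1` and `ν + σ > 2 + β`, this
> implies, for `D` sufficiently large [...] If `D` is large enough, we have
> `T ≤ D^σ ≤ binom(D+1, 2)`, and Proposition 10 gives [...] using `(3/2)σ < 1 + σ < β`.

The largeness conditions of the level data of `RoySmallValueEstimatesLevelDataProofs` (parameters
`Tl = ⌊D^σ⌋`, `Lc`, `kl`, `Yl = 3D^β`, `Ul = D^ν/4`, `S0`) are discharged here as
`∀ᶠ D : ℕ in atTop` statements under `1 ≤ σ < 2`, `σ + 1 < β`, `2 + β − σ < ν`: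

* `sqrt_two_Tl_le`, `Lc_add_two_le`, **`eventually_Lc_lt`** (`Lc < D`, from `σ < 2`);
* `cInterp`, `interpConst_eq`, `log_two_mul_c10_le` (`log(2c₁₀(L)) ≤ C (L+2)³`) and
  **`eventually_interpConst_le`**, **`eventually_log_c10_le`** (from `(3/2)σ < β`);
* **`eventually_slack_Y`**, **`eventually_slack_U`** (`D(D²)^D e^{2D^β} ≤ e^{3D^β}`,
  `D(D²)^D e^{−D^ν/2} ≤ e^{−D^ν/4}`);
* `card_phiRow_le`, `card_antidiag_two_le`, `log_factorial_le`, **`eventually_log_S0_le`**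
  (`log S₀ ≤ −D^{σ+ν}/16`, from `σ + ν > 2 + β`), **`eventually_heightSum_le`**
  (`log N! + 2N₀Y ≤ 38D^{2+β}`), **`eventually_c4_le`** (`4c₄D² ≤ D^{1+β−σ}`).

## References

* [NguyenRoy2016] N. A. V. Nguyen, D. Roy, IJNT 12 (2016) 1273–1293 = arXiv:1412.5163, §5 (the
  largeness conditions in the proofs of Propositions 14, 15 and Corollary 16).
-/

noncomputable section

open MvPolynomial Finset Module Filter Topology

namespace Literature.NumberTheory.Transcendental

namespace NguyenRoy

open Roy2013
open Nesterenko hiding tau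

/-! ### The interpolation level `Lc` -/

/-- `⌊√(2T)⌋ ≤ √2 · D^{σ/2}`. [folklore] -/
theorem sqrt_two_Tl_le (σ : ℝ) (D : ℕ) :
    (Nat.sqrt (2 * Tl σ D) : ℝ) ≤ Real.sqrt 2 * (D : ℝ) ^ (σ / 2) := by
  set q := Nat.sqrt (2 * Tl σ D) with hq
  have h1 : q ^ 2 ≤ 2 * Tl σ D := Nat.sqrt_le' _
  have h2 : (q : ℝ) ^ 2 ≤ 2 * (D : ℝ) ^ σ := by
    have h3 : ((q ^ 2 : ℕ) : ℝ) ≤ ((2 * Tl σ D : ℕ) : ℝ) := by exact_mod_cast h1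
    push_cast at h3
    have hT : (Tl σ D : ℝ) ≤ (D : ℝ) ^ σ := natFloor_rpow_le D σ
    exact h3.trans (by linarith)
  have hD : (0 : ℝ) ≤ D := Nat.cast_nonneg _
  calc (q : ℝ) = Real.sqrt ((q : ℝ) ^ 2) := (Real.sqrt_sq (Nat.cast_nonneg _)).symm
    _ ≤ Real.sqrt (2 * (D : ℝ) ^ σ) := Real.sqrt_le_sqrt h2
    _ = Real.sqrt 2 * Real.sqrt ((D : ℝ) ^ σ) := Real.sqrt_mul (by norm_num) _
    _ = Real.sqrt 2 * (D : ℝ) ^ (σ / 2) := by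
        rw [Real.sqrt_eq_rpow ((D : ℝ) ^ σ), ← Real.rpow_mul hD]
        congr 1; ring_nf

/-- `Lc + 2 ≤ 5 D^{σ/2}` (`D ≥ 1`, `σ ≥ 0`). [folklore] -/
theorem Lc_add_two_le {σ : ℝ} (hσ : 0 ≤ σ) {D : ℕ} (hD : 1 ≤ D) :
    ((Lc σ D + 2 : ℕ) : ℝ) ≤ 5 * (D : ℝ) ^ (σ / 2) := by
  have h1 := sqrt_two_Tl_le σ D
  have h2 : (1 : ℝ) ≤ (D : ℝ) ^ (σ / 2) := Real.one_le_rpow (by exact_mod_cast hD) (by linarith)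
  have h3 : Real.sqrt 2 ≤ 2 := by
    rw [show (2 : ℝ) = Real.sqrt 4 by rw [show (4 : ℝ) = 2 ^ 2 by norm_num, Real.sqrt_sq (by norm_num)]]
    exact Real.sqrt_le_sqrt (by norm_num)
  rw [Lc]; push_cast
  have h4 : 0 ≤ (D : ℝ) ^ (σ / 2) := by linarith
  nlinarith

/-- `(Lc + 2)³ ≤ 125 D^{3σ/2}`. [folklore] -/
theorem Lc_add_two_pow_three_le {σ : ℝ} (hσ : 0 ≤ σ) {D : ℕ} (hD : 1 ≤ D) :
    ((Lc σ D + 2 : ℕ) : ℝ) ^ 3 ≤ 125 * (D : ℝ) ^ (3 * σ / 2) := by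
  have h := Lc_add_two_le hσ hD
  have h0 : (0 : ℝ) ≤ ((Lc σ D + 2 : ℕ) : ℝ) := Nat.cast_nonneg _
  have hD0 : (0 : ℝ) ≤ D := Nat.cast_nonneg _
  calc ((Lc σ D + 2 : ℕ) : ℝ) ^ 3 ≤ (5 * (D : ℝ) ^ (σ / 2)) ^ 3 := pow_le_pow_left₀ h0 h 3
    _ = 125 * ((D : ℝ) ^ (σ / 2)) ^ (3 : ℕ) := by ring
    _ = 125 * (D : ℝ) ^ (3 * σ / 2) := by
        rw [← Real.rpow_natCast, ← Real.rpow_mul hD0]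
        congr 1; push_cast; ring_nf

/-- **`Lc < D` for large `D`** (`σ < 2`). [cite: NguyenRoy2016, proof of Corollary 16 ("`T ≤ D^σ ≤ binom(D+1,2)`")] -/
theorem eventually_Lc_lt {σ : ℝ} (hσ0 : 0 ≤ σ) (hσ2 : σ < 2) : ∀ᶠ D : ℕ in atTop, Lc σ D < D := by
  have h := eventually_const_mul_rpow_le_rpow 5 (show σ / 2 < 1 by linarith)
  filter_upwards [h, eventually_ge_atTop 1] with D hD hD1
  have h1 := Lc_add_two_le hσ0 hD1
  rw [Real.rpow_one] at hD
  have h2 : ((Lc σ D + 2 : ℕ) : ℝ) ≤ D := h1.trans hD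
  have h3 : Lc σ D + 2 ≤ D := by exact_mod_cast h2
  omega

/-! ### The interpolation constant and the constant of Proposition 10 -/

/-- The base constant `c = 16 c₁ |s| min(1, |s|−1)⁻²` of Proposition 8. [cite: NguyenRoy2016, Proposition 8] -/
def cInterp (ξ η r s : ℂ) : ℝ :=
  16 * (max 1 ‖η‖⁻¹ * (1 + ‖ξ‖) * max 1 ‖r‖⁻¹) * ‖s‖ * (min 1 (‖s‖ - 1))⁻¹ ^ 2

/-- `interpConst(L) = c^{(L+1)³}`. [folklore] -/
theorem interpConst_eq (ξ η r s : ℂ) (L : ℕ) :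
    interpConst ξ η r s L = cInterp ξ η r s ^ ((L + 1) ^ 3) := rfl

/-- `c ≥ 1` for `|s| > 1`. [folklore] -/
theorem one_le_cInterp (ξ η r : ℂ) {s : ℂ} (hs : 1 < ‖s‖) : 1 ≤ cInterp ξ η r s := by
  unfold cInterp
  have h1 : 1 ≤ max 1 ‖η‖⁻¹ := le_max_left _ _
  have h2 : 1 ≤ max 1 ‖r‖⁻¹ := le_max_left _ _
  have h3 : 1 ≤ 1 + ‖ξ‖ := by linarith [norm_nonneg ξ]
  have hmin0 : 0 < min 1 (‖s‖ - 1) := lt_min one_pos (by linarith)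
  have hmin1 : min 1 (‖s‖ - 1) ≤ 1 := min_le_left _ _
  have h4 : 1 ≤ (min 1 (‖s‖ - 1))⁻¹ := (one_le_inv₀ hmin0).mpr hmin1
  have h5 : 1 ≤ (min 1 (‖s‖ - 1))⁻¹ ^ 2 := one_le_pow₀ h4
  have h6 : 1 ≤ max 1 ‖η‖⁻¹ * (1 + ‖ξ‖) * max 1 ‖r‖⁻¹ :=
    one_le_mul_of_one_le_of_one_le (one_le_mul_of_one_le_of_one_le h1 h3) h2
  have h16 : (1 : ℝ) ≤ 16 := by norm_num
  exact one_le_mul_of_one_le_of_one_le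
    (one_le_mul_of_one_le_of_one_le (one_le_mul_of_one_le_of_one_le h16 h6) hs.le) h5

/-- `log interpConst(L) ≤ (L+2)³ log c`. [folklore] -/
theorem log_interpConst_le (ξ η r : ℂ) {s : ℂ} (hs : 1 < ‖s‖) (L : ℕ) :
    Real.log (interpConst ξ η r s L) ≤ ((L + 2 : ℕ) : ℝ) ^ 3 * Real.log (cInterp ξ η r s) := by
  rw [interpConst_eq, Real.log_pow]
  have hc : 0 ≤ Real.log (cInterp ξ η r s) := Real.log_nonneg (one_le_cInterp ξ η r hs)
  refine mul_le_mul_of_nonneg_right ?_ hc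
  exact_mod_cast Nat.pow_le_pow_left (Nat.le_succ _) 3

/-- **`interpConst(Lc) ≤ e^{Y}` for large `D`** (`(3/2)σ < β`).
[cite: NguyenRoy2016, proof of Corollary 16 ("using `(3/2)σ < 1 + σ < β`")] -/
theorem eventually_interpConst_le (ξ η r : ℂ) {s : ℂ} (hs : 1 < ‖s‖) {σ β : ℝ} (hσ : 0 ≤ σ)
    (hσβ : 3 * σ / 2 < β) :
    ∀ᶠ D : ℕ in atTop, interpConst ξ η r s (Lc σ D) ≤ Real.exp (Yl β D) := by
  have h := eventually_const_mul_rpow_le_rpow (125 * Real.log (cInterp ξ η r s)) hσβ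
  filter_upwards [h, eventually_ge_atTop 1] with D hD hD1
  have hc : 0 ≤ Real.log (cInterp ξ η r s) := Real.log_nonneg (one_le_cInterp ξ η r hs)
  have hpos : 0 < interpConst ξ η r s (Lc σ D) := by
    rw [interpConst_eq]; exact pow_pos (lt_of_lt_of_le one_pos (one_le_cInterp ξ η r hs)) _
  rw [← Real.exp_log hpos, Real.exp_le_exp, Yl]
  have h1 := log_interpConst_le ξ η r hs (Lc σ D)
  have h2 := Lc_add_two_pow_three_le hσ hD1
  have h3 : 0 ≤ (D : ℝ) ^ β := Real.rpow_nonneg (Nat.cast_nonneg _) _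
  calc Real.log (interpConst ξ η r s (Lc σ D))
      ≤ ((Lc σ D + 2 : ℕ) : ℝ) ^ 3 * Real.log (cInterp ξ η r s) := h1
    _ ≤ 125 * (D : ℝ) ^ (3 * σ / 2) * Real.log (cInterp ξ η r s) :=
        mul_le_mul_of_nonneg_right h2 hc
    _ = 125 * Real.log (cInterp ξ η r s) * (D : ℝ) ^ (3 * σ / 2) := by ring
    _ ≤ (D : ℝ) ^ β := hD
    _ ≤ 3 * (D : ℝ) ^ β := by linarith

/-- **`log(2c₁₀(L)) ≤ C (L+2)³`** with `C = 3 + log c + log(4P) + 1 + log|s|`,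
`P = 1 + |ξ| + |r| + |η|`. [cite: NguyenRoy2016, proof of Corollary 16 (`T^{3/2} log(c₃) ≤ D^β/2`)] -/
theorem log_two_mul_c10_le (ξ η r : ℂ) {s : ℂ} (hs : 1 < ‖s‖) (L : ℕ) :
    Real.log (2 * c10 ξ η r s L) ≤
      (3 + Real.log (cInterp ξ η r s) + (Real.log (4 * (1 + ‖ξ‖ + ‖r‖ + ‖η‖)) + 1 + Real.log ‖s‖)) *
        ((L + 2 : ℕ) : ℝ) ^ 3 := by
  set M : ℕ := (L + 1) * (L + 2) / 2 with hM
  set c := cInterp ξ η r s with hcdef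
  set P : ℝ := 1 + ‖ξ‖ + ‖r‖ + ‖η‖ with hP
  set base : ℝ := 1 + ‖ξ‖ + (M : ℝ) * ‖r‖ + ‖η‖ * ‖s‖ ^ M with hbase
  have hc1 : 1 ≤ c := one_le_cInterp ξ η r hs
  have hlogc : 0 ≤ Real.log c := Real.log_nonneg hc1
  have hs0 : 0 < ‖s‖ := by linarith
  have hlogs : 0 ≤ Real.log ‖s‖ := Real.log_nonneg hs.le
  have hP1 : 1 ≤ P := by rw [hP]; linarith [norm_nonneg ξ, norm_nonneg r, norm_nonneg η]
  have hM1 : 1 ≤ M := by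
    rw [hM]
    have : 2 ≤ (L + 1) * (L + 2) := by nlinarith
    omega
  have hM1r : (1 : ℝ) ≤ M := by exact_mod_cast hM1
  have hMle : M + 1 ≤ (L + 2) ^ 2 := by
    rw [hM]
    have h1 : (L + 1) * (L + 2) / 2 ≤ (L + 1) * (L + 2) / 2 := le_rfl
    have h2 : (L + 1) * (L + 2) / 2 * 2 ≤ (L + 1) * (L + 2) := Nat.div_mul_le_self _ _
    nlinarith
  have hMler : ((M : ℝ) + 1) ≤ ((L + 2 : ℕ) : ℝ) ^ 2 := by exact_mod_cast hMle
  have hL2 : (1 : ℝ) ≤ ((L + 2 : ℕ) : ℝ) := by exact_mod_cast (show 1 ≤ L + 2 by omega)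
  have hL3 : ((L + 2 : ℕ) : ℝ) ^ 2 ≤ ((L + 2 : ℕ) : ℝ) ^ 3 :=
    pow_le_pow_right₀ hL2 (by norm_num)
  -- the expression of `c10`
  have hc10 : c10 ξ η r s L = 2 * (M : ℝ) * c ^ ((L + 1) ^ 3) * base ^ L := by
    rw [c10, hcdef, cInterp, hbase, hM]
  have hsM : 1 ≤ ‖s‖ ^ M := one_le_pow₀ hs.le
  have hbase1 : 1 ≤ base := by
    rw [hbase]
    have : 0 ≤ (M : ℝ) * ‖r‖ + ‖η‖ * ‖s‖ ^ M := by positivity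
    linarith [norm_nonneg ξ]
  -- `base ≤ 4 P (M+1) |s|^M`
  have hbase_le : base ≤ 4 * P * ((M : ℝ) + 1) * ‖s‖ ^ M := by
    have hunit : 1 ≤ P * ((M : ℝ) + 1) * ‖s‖ ^ M := by
      calc (1 : ℝ) = 1 * 1 * 1 := by ring
        _ ≤ P * ((M : ℝ) + 1) * ‖s‖ ^ M := by gcongr; linarith
    have h1 : ‖ξ‖ ≤ P * ((M : ℝ) + 1) * ‖s‖ ^ M := by
      calc ‖ξ‖ ≤ P := by rw [hP]; linarith [norm_nonneg r, norm_nonneg η]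
        _ = P * 1 * 1 := by ring
        _ ≤ P * ((M : ℝ) + 1) * ‖s‖ ^ M := by gcongr; linarith
    have h2 : (M : ℝ) * ‖r‖ ≤ P * ((M : ℝ) + 1) * ‖s‖ ^ M := by
      calc (M : ℝ) * ‖r‖ = ‖r‖ * M * 1 := by ring
        _ ≤ P * ((M : ℝ) + 1) * ‖s‖ ^ M := by
            gcongr
            · rw [hP]; linarith [norm_nonneg ξ, norm_nonneg η]
            · linarith
    have h3 : ‖η‖ * ‖s‖ ^ M ≤ P * ((M : ℝ) + 1) * ‖s‖ ^ M := by
      calc ‖η‖ * ‖s‖ ^ M = ‖η‖ * 1 * ‖s‖ ^ M := by ring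
        _ ≤ P * ((M : ℝ) + 1) * ‖s‖ ^ M := by
            gcongr
            · rw [hP]; linarith [norm_nonneg ξ, norm_nonneg r]
            · linarith
    rw [hbase]; linarith
  have hlogbase : Real.log base ≤ (Real.log (4 * P) + 1 + Real.log ‖s‖) * ((M : ℝ) + 1) := by
    have h4P : 0 < 4 * P := by linarith
    have hM0 : 0 < (M : ℝ) + 1 := by linarith
    calc Real.log base ≤ Real.log (4 * P * ((M : ℝ) + 1) * ‖s‖ ^ M) :=
          Real.log_le_log (by linarith) hbase_le
      _ = Real.log (4 * P) + Real.log ((M : ℝ) + 1) + M * Real.log ‖s‖ := by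
          rw [Real.log_mul (by positivity) (by positivity), Real.log_mul h4P.ne' hM0.ne',
            Real.log_pow]
      _ ≤ Real.log (4 * P) + ((M : ℝ) + 1) + ((M : ℝ) + 1) * Real.log ‖s‖ := by
          have h1 : Real.log ((M : ℝ) + 1) ≤ (M : ℝ) + 1 :=
            (Real.log_le_sub_one_of_pos hM0).trans (by linarith)
          have h2 : (M : ℝ) * Real.log ‖s‖ ≤ ((M : ℝ) + 1) * Real.log ‖s‖ :=
            mul_le_mul_of_nonneg_right (by linarith) hlogs
          linarith
      _ ≤ (Real.log (4 * P) + 1 + Real.log ‖s‖) * ((M : ℝ) + 1) := by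
          have h1 : 0 ≤ Real.log (4 * P) := Real.log_nonneg (by linarith)
          nlinarith
  -- assemble
  have hMpos : 0 < (M : ℝ) := by linarith
  have hcpow : 0 < c ^ ((L + 1) ^ 3) := pow_pos (by linarith) _
  have hbpow : 0 < base ^ L := pow_pos (by linarith) _
  rw [hc10, show 2 * (2 * (M : ℝ) * c ^ ((L + 1) ^ 3) * base ^ L) =
    4 * (M : ℝ) * (c ^ ((L + 1) ^ 3) * base ^ L) by ring,
    Real.log_mul (by positivity) (by positivity), Real.log_mul (by norm_num) hMpos.ne',
    Real.log_mul hcpow.ne' hbpow.ne', Real.log_pow, Real.log_pow]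
  have hlog4 : Real.log 4 ≤ 2 := by
    have := Real.log_le_sub_one_of_pos (show (0 : ℝ) < 4 by norm_num)
    have h2 : Real.log 4 = 2 * Real.log 2 := by
      rw [show (4 : ℝ) = 2 ^ 2 by norm_num, Real.log_pow]; ring
    rw [h2]
    have := Real.log_two_lt_d9
    linarith
  have hlogM : Real.log M ≤ ((L + 2 : ℕ) : ℝ) ^ 3 := by
    have h1 : Real.log M ≤ (M : ℝ) := (Real.log_le_sub_one_of_pos hMpos).trans (by linarith)
    nlinarith
  have hL13 : (((L + 1) ^ 3 : ℕ) : ℝ) ≤ ((L + 2 : ℕ) : ℝ) ^ 3 := by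
    exact_mod_cast Nat.pow_le_pow_left (Nat.le_succ _) 3
  have hterm3 : (((L + 1) ^ 3 : ℕ) : ℝ) * Real.log c ≤ ((L + 2 : ℕ) : ℝ) ^ 3 * Real.log c :=
    mul_le_mul_of_nonneg_right hL13 hlogc
  have hLM : (L : ℝ) * ((M : ℝ) + 1) ≤ ((L + 2 : ℕ) : ℝ) ^ 3 := by
    have h1 : (L : ℝ) ≤ ((L + 2 : ℕ) : ℝ) := by exact_mod_cast (show L ≤ L + 2 by omega)
    calc (L : ℝ) * ((M : ℝ) + 1) ≤ ((L + 2 : ℕ) : ℝ) * ((L + 2 : ℕ) : ℝ) ^ 2 := by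
          gcongr
      _ = ((L + 2 : ℕ) : ℝ) ^ 3 := by ring
  have hC1 : 0 ≤ Real.log (4 * P) + 1 + Real.log ‖s‖ := by
    have : 0 ≤ Real.log (4 * P) := Real.log_nonneg (by linarith)
    linarith
  have hterm4 : (L : ℝ) * Real.log base ≤
      (Real.log (4 * P) + 1 + Real.log ‖s‖) * ((L + 2 : ℕ) : ℝ) ^ 3 := by
    calc (L : ℝ) * Real.log base ≤ (L : ℝ) * ((Real.log (4 * P) + 1 + Real.log ‖s‖) * ((M : ℝ) + 1)) :=
          mul_le_mul_of_nonneg_left hlogbase (Nat.cast_nonneg _)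
      _ = (Real.log (4 * P) + 1 + Real.log ‖s‖) * ((L : ℝ) * ((M : ℝ) + 1)) := by ring
      _ ≤ (Real.log (4 * P) + 1 + Real.log ‖s‖) * ((L + 2 : ℕ) : ℝ) ^ 3 :=
          mul_le_mul_of_nonneg_left hLM hC1
  have hL31 : (1 : ℝ) ≤ ((L + 2 : ℕ) : ℝ) ^ 3 := one_le_pow₀ hL2
  nlinarith

/-- **`log(2c₁₀(Lc)) ≤ D^β` for large `D`** (`(3/2)σ < β`).
[cite: NguyenRoy2016, proof of Corollary 16 ("`T^{3/2} log(c₃) ≤ D^β/2` using `(3/2)σ < 1 + σ < β`")] -/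
theorem eventually_log_c10_le (ξ η r : ℂ) {s : ℂ} (hs : 1 < ‖s‖) {σ β : ℝ} (hσ : 0 ≤ σ)
    (hσβ : 3 * σ / 2 < β) :
    ∀ᶠ D : ℕ in atTop, Real.log (2 * c10 ξ η r s (Lc σ D)) ≤ (D : ℝ) ^ β := by
  set C : ℝ := 3 + Real.log (cInterp ξ η r s) +
    (Real.log (4 * (1 + ‖ξ‖ + ‖r‖ + ‖η‖)) + 1 + Real.log ‖s‖) with hC
  have hC0 : 0 ≤ C := by
    have h1 : 0 ≤ Real.log (cInterp ξ η r s) := Real.log_nonneg (one_le_cInterp ξ η r hs)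
    have h2 : 0 ≤ Real.log (4 * (1 + ‖ξ‖ + ‖r‖ + ‖η‖)) :=
      Real.log_nonneg (by linarith [norm_nonneg ξ, norm_nonneg r, norm_nonneg η])
    have h3 : 0 ≤ Real.log ‖s‖ := Real.log_nonneg hs.le
    rw [hC]; linarith
  have h := eventually_const_mul_rpow_le_rpow (C * 125) hσβ
  filter_upwards [h, eventually_ge_atTop 1] with D hD hD1
  have h1 := log_two_mul_c10_le ξ η r hs (Lc σ D)
  rw [← hC] at h1
  have h2 := Lc_add_two_pow_three_le hσ hD1
  calc Real.log (2 * c10 ξ η r s (Lc σ D)) ≤ C * ((Lc σ D + 2 : ℕ) : ℝ) ^ 3 := h1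
    _ ≤ C * (125 * (D : ℝ) ^ (3 * σ / 2)) := mul_le_mul_of_nonneg_left h2 hC0
    _ = C * 125 * (D : ℝ) ^ (3 * σ / 2) := by ring
    _ ≤ (D : ℝ) ^ β := hD

/-! ### The slack inequalities for the companion `Q` -/

/-- `D (D²)^D = D^{2D+1} = e^{(2D+1) log D}` for `D ≥ 1`. [folklore] -/
theorem mul_sq_pow_eq_exp {D : ℕ} (hD : 1 ≤ D) :
    (D : ℝ) * ((D : ℝ) ^ 2) ^ D = Real.exp (((2 * D + 1 : ℕ) : ℝ) * Real.log D) := by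
  have hD0 : (0 : ℝ) < D := by exact_mod_cast hD
  rw [Real.exp_nat_mul, Real.exp_log hD0, ← pow_mul, pow_succ, mul_comm]

/-- `(2D+1) log D ≤ 3 D log D` for `D ≥ 1`. [folklore] -/
theorem two_mul_add_one_mul_log_le {D : ℕ} (hD : 1 ≤ D) :
    ((2 * D + 1 : ℕ) : ℝ) * Real.log D ≤ 3 * (D : ℝ) ^ (1 : ℝ) * Real.log D ^ 1 := by
  rw [Real.rpow_one, pow_one]
  have hlog : 0 ≤ Real.log D := Real.log_nonneg (by exact_mod_cast hD)
  have h1 : ((2 * D + 1 : ℕ) : ℝ) ≤ 3 * D := by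
    have : (1 : ℝ) ≤ D := by exact_mod_cast hD
    push_cast; linarith
  exact mul_le_mul_of_nonneg_right h1 hlog

/-- **`D(D²)^D e^{2D^β} ≤ e^{Y}` for large `D`** (`β > 1`). [folklore] -/
theorem eventually_slack_Y {β : ℝ} (hβ : 1 < β) :
    ∀ᶠ D : ℕ in atTop, (D : ℝ) * ((D : ℝ) ^ 2) ^ D * Real.exp (2 * (D : ℝ) ^ β) ≤ Real.exp (Yl β D) := by
  have h := eventually_nat_mul_rpow_mul_log_pow_le' 1 β 3 1 one_pos hβ
  filter_upwards [h, eventually_ge_atTop 1] with D hD hD1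
  rw [mul_sq_pow_eq_exp hD1, ← Real.exp_add, Real.exp_le_exp, Yl]
  have h1 := two_mul_add_one_mul_log_le hD1
  linarith

/-- **`D(D²)^D e^{−D^ν/2} ≤ e^{−U}` for large `D`** (`ν > 1`). [folklore] -/
theorem eventually_slack_U {ν : ℝ} (hν : 1 < ν) :
    ∀ᶠ D : ℕ in atTop,
      (D : ℝ) * ((D : ℝ) ^ 2) ^ D * Real.exp (-(D : ℝ) ^ ν / 2) ≤ Real.exp (-Ul ν D) := by
  have h := eventually_nat_mul_rpow_mul_log_pow_le' 1 ν 3 1 (show (0 : ℝ) < 1 / 4 by norm_num) hν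
  filter_upwards [h, eventually_ge_atTop 1] with D hD hD1
  rw [mul_sq_pow_eq_exp hD1, ← Real.exp_add, Real.exp_le_exp, Ul]
  have h1 := two_mul_add_one_mul_log_le hD1
  linarith

/-! ### Cardinalities and factorials -/

/-- `N = #rows of Φ = binom(3D+2, 2) ≤ 10D²` (`D ≥ 1`). [folklore] -/
theorem card_phiRow_le {D : ℕ} (hD : 1 ≤ D) : (Fintype.card (PhiRow D) : ℝ) ≤ 10 * (D : ℝ) ^ 2 := by
  have h : Fintype.card (PhiRow D) = (3 * D + 2).choose 2 := card_finsuppAntidiag_fin_three _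
  rw [h]
  exact choose_three_le hD

/-- `N₀ = dim ℂ[X]_{2D} = binom(2D+2, 2) ≤ 5D²` (`D ≥ 2`). [folklore] -/
theorem card_antidiag_two_le {D : ℕ} (hD : 2 ≤ D) :
    (Fintype.card ↥(finsuppAntidiag (univ : Finset (Fin 3)) (2 * D)) : ℝ) ≤ 5 * (D : ℝ) ^ 2 := by
  rw [card_finsuppAntidiag_fin_three]
  exact choose_two_le hD

/-- `1 ≤ N`. [folklore] -/
theorem one_le_card_phiRow (D : ℕ) : 1 ≤ Fintype.card (PhiRow D) := by
  rw [card_finsuppAntidiag_fin_three]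
  exact Nat.succ_le_of_lt (Nat.choose_pos (by omega))

/-- `log N! ≤ N log N`. [folklore] -/
theorem log_factorial_le (N : ℕ) : Real.log (N.factorial : ℝ) ≤ N * Real.log N := by
  rcases Nat.eq_zero_or_pos N with rfl | hN
  · simp
  · have h1 : (N.factorial : ℝ) ≤ (N : ℝ) ^ N := by exact_mod_cast Nat.factorial_le_pow N
    calc Real.log (N.factorial : ℝ) ≤ Real.log ((N : ℝ) ^ N) :=
          Real.log_le_log (by exact_mod_cast Nat.factorial_pos N) h1
      _ = N * Real.log N := Real.log_pow _ _

/-- `log N! ≤ 90D² + 20D² log D` (`D ≥ 1`). [folklore] -/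
theorem log_factorial_phiRow_le {D : ℕ} (hD : 1 ≤ D) :
    Real.log ((Fintype.card (PhiRow D)).factorial : ℝ) ≤ 90 * (D : ℝ) ^ 2 + 20 * (D : ℝ) ^ 2 * Real.log D := by
  have hN := card_phiRow_le hD
  have hN1 : (1 : ℝ) ≤ Fintype.card (PhiRow D) := by exact_mod_cast one_le_card_phiRow D
  have hD1 : (1 : ℝ) ≤ D := by exact_mod_cast hD
  have hlogD : 0 ≤ Real.log D := Real.log_nonneg hD1
  have hlogN : Real.log (Fintype.card (PhiRow D) : ℝ) ≤ Real.log 10 + 2 * Real.log D := by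
    calc Real.log (Fintype.card (PhiRow D) : ℝ) ≤ Real.log (10 * (D : ℝ) ^ 2) :=
          Real.log_le_log (by linarith) hN
      _ = Real.log 10 + 2 * Real.log D := by
          rw [Real.log_mul (by norm_num) (by positivity), Real.log_pow]; ring
  have hlog10 : Real.log 10 ≤ 9 := by
    have := Real.log_le_sub_one_of_pos (show (0 : ℝ) < 10 by norm_num)
    linarith
  have hlogN0 : 0 ≤ Real.log (Fintype.card (PhiRow D) : ℝ) := Real.log_nonneg hN1
  calc Real.log ((Fintype.card (PhiRow D)).factorial : ℝ)
      ≤ (Fintype.card (PhiRow D) : ℝ) * Real.log (Fintype.card (PhiRow D) : ℝ) := log_factorial_le _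
    _ ≤ 10 * (D : ℝ) ^ 2 * (Real.log 10 + 2 * Real.log D) :=
        mul_le_mul hN hlogN hlogN0 (by positivity)
    _ ≤ 90 * (D : ℝ) ^ 2 + 20 * (D : ℝ) ^ 2 * Real.log D := by nlinarith [sq_nonneg (D : ℝ)]

/-! ### The bound `S₀` of Proposition 15 -/

/-- `2^k ≤ 2D²` (`D ≥ 2`). [folklore] -/
theorem two_pow_kl_le {D : ℕ} (hD : 2 ≤ D) : 2 ^ kl D ≤ 2 * D ^ 2 := by
  have hx : 1 < D ^ 2 := by nlinarith
  have h := Nat.pow_pred_clog_lt_self one_lt_two hx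
  have hk : 0 < kl D := Nat.clog_pos one_lt_two (by nlinarith)
  rw [kl] at hk ⊢
  have hk' : Nat.clog 2 (D ^ 2) = (Nat.clog 2 (D ^ 2)).pred + 1 := (Nat.succ_pred_eq_of_pos hk).symm
  rw [hk', pow_succ]
  omega

/-- `2k2^k log 2 ≤ 8D⁴` (`D ≥ 2`). [folklore] -/
theorem kl_term_le {D : ℕ} (hD : 2 ≤ D) :
    ((2 * kl D * 2 ^ kl D : ℕ) : ℝ) * Real.log 2 ≤ 8 * (D : ℝ) ^ 4 := by
  have h1 : kl D ≤ 2 ^ kl D := (Nat.lt_two_pow_self).le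
  have h2 := two_pow_kl_le hD
  have h3 : 2 * kl D * 2 ^ kl D ≤ 2 * (2 * D ^ 2) * (2 * D ^ 2) :=
    Nat.mul_le_mul (Nat.mul_le_mul_left 2 (h1.trans h2)) h2
  have h4 : ((2 * kl D * 2 ^ kl D : ℕ) : ℝ) ≤ 8 * (D : ℝ) ^ 4 := by
    have : ((2 * kl D * 2 ^ kl D : ℕ) : ℝ) ≤ ((2 * (2 * D ^ 2) * (2 * D ^ 2) : ℕ) : ℝ) := by
      exact_mod_cast h3
    refine this.trans (le_of_eq ?_)
    push_cast; ring
  have hlog2 : Real.log 2 ≤ 1 := by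
    have := Real.log_two_lt_d9; linarith
  have h0 : (0 : ℝ) ≤ ((2 * kl D * 2 ^ kl D : ℕ) : ℝ) := Nat.cast_nonneg _
  nlinarith

/-- **`log S₀` in closed form.** [folklore] -/
theorem log_S0_eq (σ β ν : ℝ) (D : ℕ) :
    Real.log (S0 σ β ν D) = ((2 * kl D * 2 ^ kl D : ℕ) : ℝ) * Real.log 2 - Tl σ D * Ul ν D +
      Real.log ((Fintype.card (PhiRow D)).factorial : ℝ) +
      Fintype.card (PhiRow D) * (Real.log 3 + Yl β D) := by
  have hfact : (0 : ℝ) < ((Fintype.card (PhiRow D)).factorial : ℝ) :=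
    Nat.cast_pos.mpr (Nat.factorial_pos _)
  have h3 : (0 : ℝ) < 3 * Real.exp (Yl β D) := by positivity
  rw [S0, Real.log_mul (by positivity) (by positivity), Real.log_mul (Real.exp_pos _).ne'
    (by positivity), Real.log_mul hfact.ne' (by positivity), Real.log_pow, Real.log_pow,
    Real.log_exp, Real.log_mul (by norm_num) (Real.exp_pos _).ne', Real.log_exp]
  push_cast
  ring

/-- **`log S₀ ≤ −D^{σ+ν}/16` for large `D`** (`σ + ν > 2 + β`, `β > 2`, `σ ≥ 1`): the condition
"`−TU + 3YD² + 21 log(3)D³ < 0` for `D` large" of the proof of Proposition 15, with the height term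
of the selection included. [cite: NguyenRoy2016, proof of Proposition 15 ("Since `β > 1` and `ν + σ > 2 + β`, … for `D` sufficiently large")] -/
theorem eventually_log_S0_le {σ β ν : ℝ} (hσ1 : 1 ≤ σ) (hβ : 2 < β) (hσν : 2 + β < σ + ν) :
    ∀ᶠ D : ℕ in atTop, Real.log (S0 σ β ν D) ≤ -((D : ℝ) ^ (σ + ν)) / 16 := by
  have hc : (0 : ℝ) < 1 / 64 := by norm_num
  have e1 := eventually_nat_mul_rpow_mul_log_pow_le' 4 (σ + ν) 8 0 hc (by linarith)
  have e2 := eventually_nat_mul_rpow_mul_log_pow_le' 2 (σ + ν) 110 0 hc (by linarith)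
  have e3 := eventually_nat_mul_rpow_mul_log_pow_le' 2 (σ + ν) 20 1 hc (by linarith)
  have e4 := eventually_nat_mul_rpow_mul_log_pow_le' (2 + β) (σ + ν) 30 0 hc hσν
  filter_upwards [e1, e2, e3, e4, eventually_ge_atTop 2] with D h1 h2 h3 h4 hD2
  have hD1 : 1 ≤ D := by omega
  have hD1r : (1 : ℝ) ≤ D := by exact_mod_cast hD1
  have hD0 : (0 : ℝ) ≤ D := by linarith
  simp only [pow_zero, mul_one, pow_one] at h1 h2 h3 h4
  rw [log_S0_eq]
  -- the individual bounds
  have hk := kl_term_le hD2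
  have hN := card_phiRow_le hD1
  have hfact := log_factorial_phiRow_le hD1
  have hT : (D : ℝ) ^ σ ≤ 2 * (Tl σ D : ℝ) := rpow_le_two_mul_natFloor hD1 (by linarith)
  have hU : Ul ν D = (D : ℝ) ^ ν / 4 := rfl
  have hY : Yl β D = 3 * (D : ℝ) ^ β := rfl
  have hlog3 : Real.log 3 ≤ 2 := by
    have h : Real.log 3 ≤ Real.log (Real.exp 2) := by
      refine Real.log_le_log (by norm_num) ?_
      have := Real.add_one_le_exp (2 : ℝ); linarith
    rwa [Real.log_exp] at h
  have hβ0 : 0 ≤ (D : ℝ) ^ β := Real.rpow_nonneg hD0 _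
  have hν0 : 0 ≤ (D : ℝ) ^ ν := Real.rpow_nonneg hD0 _
  have hσ0 : 0 ≤ (D : ℝ) ^ σ := Real.rpow_nonneg hD0 _
  -- `T U ≥ D^{σ+ν}/8`
  have hTU : (D : ℝ) ^ (σ + ν) / 8 ≤ (Tl σ D : ℝ) * Ul ν D := by
    rw [hU, Real.rpow_add (by linarith)]
    have hT0 : (0 : ℝ) ≤ Tl σ D := Nat.cast_nonneg _
    nlinarith
  -- rewrite the real powers with natural exponents
  have hr4 : (D : ℝ) ^ (4 : ℝ) = (D : ℝ) ^ 4 := by exact_mod_cast Real.rpow_natCast (D : ℝ) 4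
  have hr2 : (D : ℝ) ^ (2 : ℝ) = (D : ℝ) ^ 2 := by exact_mod_cast Real.rpow_natCast (D : ℝ) 2
  rw [hr4] at h1
  rw [hr2] at h2 h3
  have h2β : (D : ℝ) ^ (2 + β) = (D : ℝ) ^ 2 * (D : ℝ) ^ β := by
    rw [Real.rpow_add (by linarith), hr2]
  rw [h2β] at h4
  -- `N (log 3 + Y) ≤ 10D²(2 + 3D^β)`
  have hNY : (Fintype.card (PhiRow D) : ℝ) * (Real.log 3 + Yl β D) ≤
      20 * (D : ℝ) ^ 2 + 30 * ((D : ℝ) ^ 2 * (D : ℝ) ^ β) := by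
    rw [hY]
    have h0 : 0 ≤ Real.log 3 + 3 * (D : ℝ) ^ β := by
      have : 0 ≤ Real.log 3 := Real.log_nonneg (by norm_num)
      linarith
    calc (Fintype.card (PhiRow D) : ℝ) * (Real.log 3 + 3 * (D : ℝ) ^ β)
        ≤ 10 * (D : ℝ) ^ 2 * (Real.log 3 + 3 * (D : ℝ) ^ β) := mul_le_mul_of_nonneg_right hN h0
      _ ≤ 10 * (D : ℝ) ^ 2 * (2 + 3 * (D : ℝ) ^ β) := by gcongr
      _ = 20 * (D : ℝ) ^ 2 + 30 * ((D : ℝ) ^ 2 * (D : ℝ) ^ β) := by ring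
  nlinarith

/-- **`log N! + 2N₀Y ≤ 38 D^{2+β}` for large `D`** (the height of `W` against `D^{2+β}`).
[cite: NguyenRoy2016, proof of Proposition 14 ("`h(W) ≤ 5D^{1+β}` thanks to Proposition 4")] -/
theorem eventually_heightSum_le {β : ℝ} (hβ : 0 < β) :
    ∀ᶠ D : ℕ in atTop, Real.log ((Fintype.card (PhiRow D)).factorial : ℝ) +
      2 * Fintype.card ↥(finsuppAntidiag (univ : Finset (Fin 3)) (2 * D)) * Yl β D ≤
        38 * (D : ℝ) ^ (2 + β) := by
  have hc : (0 : ℝ) < 4 := by norm_num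
  have e1 := eventually_nat_mul_rpow_mul_log_pow_le' 2 (2 + β) 90 0 hc (by linarith)
  have e2 := eventually_nat_mul_rpow_mul_log_pow_le' 2 (2 + β) 20 1 hc (by linarith)
  filter_upwards [e1, e2, eventually_ge_atTop 2] with D h1 h2 hD2
  have hD1 : 1 ≤ D := by omega
  have hD0 : (0 : ℝ) ≤ D := Nat.cast_nonneg _
  simp only [pow_zero, mul_one, pow_one] at h1 h2
  have hr2 : (D : ℝ) ^ (2 : ℝ) = (D : ℝ) ^ 2 := by exact_mod_cast Real.rpow_natCast (D : ℝ) 2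
  rw [hr2] at h1 h2
  have h2β : (D : ℝ) ^ (2 + β) = (D : ℝ) ^ 2 * (D : ℝ) ^ β := by
    rw [Real.rpow_add (by exact_mod_cast (show 0 < D by omega)), hr2]
  have hfact := log_factorial_phiRow_le hD1
  have hN0 := card_antidiag_two_le hD2
  have hY : Yl β D = 3 * (D : ℝ) ^ β := rfl
  have hβ0 : 0 ≤ (D : ℝ) ^ β := Real.rpow_nonneg hD0 _
  rw [hY, h2β]
  rw [h2β] at h1 h2
  have hA : 2 * (Fintype.card ↥(finsuppAntidiag (univ : Finset (Fin 3)) (2 * D)) : ℝ) *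
      (3 * (D : ℝ) ^ β) ≤ 2 * (5 * (D : ℝ) ^ 2) * (3 * (D : ℝ) ^ β) := by gcongr
  nlinarith

/-- **`4c₄D² ≤ D^{1+β−σ}` for large `D`** (`1 + β − σ > 2`). [cite: NguyenRoy2016, proof of
Proposition 14 ("`h(τⁱ(Z)) = h(Z) + O(T deg Z)`", "The conclusion follows since `β > 1 + σ`")] -/
theorem eventually_c4_le (r s : ℚ) {σ β : ℝ} (hβ : σ + 1 < β) :
    ∀ᶠ D : ℕ in atTop, 4 * AlgPt.c4 r s * (D : ℝ) ^ 2 ≤ (D : ℝ) ^ (1 + β - σ) := by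
  have h := eventually_const_mul_rpow_le_rpow (4 * AlgPt.c4 r s) (show (2 : ℝ) < 1 + β - σ by linarith)
  filter_upwards [h] with D hD
  have hr2 : (D : ℝ) ^ (2 : ℝ) = (D : ℝ) ^ 2 := by exact_mod_cast Real.rpow_natCast (D : ℝ) 2
  rwa [hr2] at hD

end NguyenRoy

end Literature.NumberTheory.Transcendental
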